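import Mathlib
import HarnessLib
import Summits.Langlands.Langlands.Theses.QuarterDeficit1951
import Summits.Langlands.Langlands.Theorems.ParityBlindBianchiArtinWeightRealisationLevelSolvableSector
import Literature.NumberTheory.Automorphic.StrongArtinCentralCharacter
import Literature.NumberTheory.Automorphic.AutomorphicRepsGL2WeightOneCleanModel
import Literature.NumberTheory.Automorphic.NewformAdelisationHeckeOperator
import Literature.NumberTheory.Automorphic.CertifiedMaassHeckeTraceCensus
import Literature.NumberTheory.Automorphic.HyperbolicLaplaceSpectrum
import Summits.Langlands.Langlands.Theorems.QuarterDeficit1951CorrespondentFingerprintStubBarrier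
import Summits.Langlands.Langlands.Theorems.QuarterDeficit1951CorrespondentFingerprintStubArchParameter
import Summits.Langlands.Langlands.Theorems.QuarterDeficit1951CorrespondentFingerprintStubCentralCharacter
import Summits.Langlands.Langlands.Theorems.QuarterDeficit1951CorrespondentFingerprintStubSatakeSmallPrimes
import Summits.Langlands.Langlands.Theorems.QuarterDeficit1951CorrespondentFingerprintStubGlue
import Summits.Langlands.Langlands.Theorems.QuarterDeficit1951CorrespondentFingerprintStubLevelOneSpherical
import Summits.Langlands.Langlands.Theorems.QuarterDeficit1951CorrespondentFingerprintStubLevelOneAssembly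
import Summits.Langlands.Langlands.Theorems.QuarterDeficit1951CorrespondentFingerprintStubLocal1951LLC
import Summits.Langlands.Langlands.Theorems.QuarterDeficit1951CorrespondentFingerprintStubDescent
import Summits.Langlands.Langlands.Theorems.QuarterDeficit1951CorrespondentFingerprintStubLocal1951RepTheory
import Summits.Langlands.Langlands.Theorems.QuarterDeficit1951CorrespondentFingerprintStubLocal1951Galois
import Literature.NumberTheory.Automorphic.GL2RSLFactorCharacter
import Literature.NumberTheory.Automorphic.GL2SphericalOfLFactorDegreeTwo
import Literature.NumberTheory.Automorphic.TateLocalFactors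
import Literature.NumberTheory.Automorphic.LocalComponentBJGenericProofs
import Literature.NumberTheory.Automorphic.NewformAdelisationHeckeLocal
import Literature.NumberTheory.Automorphic.WhittakerCoeffLocalDatum
import Literature.NumberTheory.Automorphic.GL2NewvectorUpToTwist
import Literature.NumberTheory.GaloisRepresentations.HeckeCharacterProofs

/-!
# SKELETON — crux stmt-Langlands-15898 `QuarterDeficit1951.CorrespondentFingerprint`, line `Sketch`
(lead prover-line-stmt-Langlands-15898-0, cycle 1, 2026-08-16)

The crux: an L-algebraic cuspidal correspondent `π` (summit `Corresponds RD ι π ρ`: a.e. Satake–Frobenius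
matching AND local–global compatibility at every finite place) of an irreducible, finite-image, even
`ρ : Γ_ℚ → GL₂(ℚ̄_ℓ)` of Artin conductor `1951` with `det ↔ χ₀` (order `5`) and icosahedral Frobenius
data `t²/d ∈ {0, 1, 4, roots of x² - 3x + 1}` descends to a non-zero weight-`0` Maass cusp form on
`(Γ₀(1951), χ)`, `χ` of order `5`, `λ = 1/4` exactly, `T_p`-eigen (`p ≤ 13`) with fingerprint
`μ_p² χ̄(p) ∈ Φ = {0, 1, 4, (3 ± √5)/2}`.

Line `Sketch` (cards `rational-centre-parity-barrier` + `twisted-l-degree-conductor-one`, ideator 1;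
the companion cards `even-parity-pincer` + `invert-rec-on-principal-series` of ideator 2 type the same
nodes) reshaped by the lead into seven registered stubs and a composition:

* `stub_barrier` — a bounded `1`-periodic `C²` solution of `Δu = c u`, `c > 0`, on `ℍ` vanishes
  (interior maximum principle against `y^s + y^{1-s}`); kills the integral archimedean parameters
  `{a, -a}`, `a ≠ 0`.
* `stub_archParameter` — an L-algebraic `π` that is `π(τ)` a.e. for a complex Artin `τ` has
  archimedean Harish-Chandra parameter `{a, -a}` with `a ∈ ℤ` (`IsLAlgebraic` + the centre:
  `IsPiOfArtinRep.add_eq_zero_of_hasArchParameter`).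
* `stub_centralCharacter` — if `π = π(τ)` a.e. and `det τ(Frob_p) = χ₁(p)` at the good primes then
  the centre `Z(𝔸_ℚ)` acts on `W / W'` by the Hecke character `ψ_{χ₁}` of the Dirichlet character `χ₁`
  (`IsPiOfArtinRep.exists_centralCharacter_eq_det` + `HeckeCharacter.ext_of_eventually_valueAtUniformizer_eq`).
* `stub_levelOne` — (LevelExactness) the correspondent has a `K₁(1951)`-fixed vector modulo `W'`
  (conductor of `π` divides `1951`: sphericality at every `p ≠ 1951` and a `K₁(𝔭)`-vector at `1951`
  from local–global compatibility, the accepted LLC datum and `artinConductorNat ρ = 1951`).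
* `stub_satakeSmallPrimes` — local–global compatibility at a place `v ∤ ℓ` where the finite-image `ρ`
  is unramified gives Satake–Frobenius compatibility at `v` (unramified inversion of the typed `rec`).
* `stub_glue` — (one vector) clean model + level subspace + even `SO(2)`-ladder: a non-zero cusp form
  `φ₀` which is `K₁(N)`-fixed, has central character `ψ_{χ₁}`, `SO(2)`-weight `0`, `Z φ₀ = 0`,
  Casimir scalar `2a² - 1/2`, and is an exact eigenvector of the unramified Hecke operators with the
  Satake eigenvalues.
* `stub_descent` — (NewformDictionary, weight `0`) such a `φ₀` descends to `u(τ) = φ₀((y x; 0 1)_∞)`,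
  a non-zero weight-`0` Maass cusp form on `(Γ₀(N), χ₁)` of eigenvalue `-c/2` (`c` the Casimir
  scalar), and `T_{p,1} φ₀ = c₁ φ₀`, `T_{p,2} φ₀ = c₂ φ₀` descend to `T_p u = (c₁/√p) u`, `c₂ = χ₁(p)`.
* `CorrespondentFingerprint_of` — the crux BY NAME from the seven stubs: contragredient transport
  `τ = ι ∘ ρ^∨` (`exists_dual_transport`), `IsPiOfArtinRep τ π` from `Corresponds.1`, `det τ(Frob) = χ₀`,
  even sign from `χ₀(-1) = 1` (order `5`), barrier ⇒ `a = 0` ⇒ `λ = 1/4`, fingerprint algebra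
  `(α + β)²/(αβ) = ι(t²/d) ∈ Φ`.
-/

set_option linter.dupNamespace false

noncomputable section

open scoped BigOperators Matrix NumberField MatrixGroups NNReal Polynomial ComplexConjugate Classical
open Literature.NumberTheory.Automorphic Literature.NumberTheory.GaloisRepresentations
  IsDedekindDomain NumberField Filter Polynomial
open Literature.NumberTheory.Automorphic.GL2Real
open Rat.HeightOneSpectrum
open Summit.Langlands
open Literature.NumberTheory.GaloisRepresentations.IsNonarchimedeanLocalField
open Field ValuativeRel MeasureTheory

namespace Summit.Langlands.Langlands.Theorems.CorrespondentFingerprint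

/-! LANDED stubs (imported, same names): `stub_barrier` (p129075, `…StubBarrier.lean`), `stub_archParameter` (p128712,
`…StubArchParameter.lean`), `stub_centralCharacter` (p128762, `…StubCentralCharacter.lean`),
`stub_satakeSmallPrimes` (p128915, `…StubSatakeSmallPrimes.lean`), `stub_glue` (p130032, `…StubGlue.lean` +
`…StubGlueEvenLadder.lean` p129288 + `…StubGlueTransfer.lean` p129734). OPEN: `stub_local1951_galois`/`stub_local1951_llc`/`stub_local1951_reptheory` (C1/C2/C3, wave 2) composing `stub_levelOne_local1951` (reshape of
`stub_levelOne`, whose global half landed: `stub_levelOne_spherical` p129624, `stub_levelOne_assembly` p129825),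
`stub_descent`. -/

/-! ## Stub 4 — LevelExactness, reshaped: the local conductor-one statement at `1951` -/

/-! (C1) `stub_local1951_galois` — LANDED p131844 (`…StubLocal1951Galois.lean` + Conductor p131319, LinAlg p131506), imported. -/

/-! (C2) `stub_local1951_llc` — LANDED p130907 (`…StubLocal1951LLC.lean`), imported. -/

/-! (C3) `stub_local1951_reptheory` — LANDED p131706 (`…StubLocal1951RepTheory.lean` + Aux1 p131312, Aux2 p131313), imported. -/

/-- **Registered stub `stub_levelOne_local1951`, PROVED from (C1), (C2), (C3).**  Glue: `v ∤ ℓ`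
(`q_v = 1951 ≠ ℓ`), the local–global clause at `v` (`Corresponds.2 v`), genericity of the cuspidal
local component (`exists_isGeneric_of_hasLocalComponentAt`), and the translation of the `K₁(𝔭)`
conditions `k ∈ GL₂(𝒪)`, `|k₂₁| < 1`, `|k₂₂ - 1| < 1` into `IsLocK1 v (1951)`
(`glInt_adicCompletion_eq`, `normAbs_lt_one_iff`, `valuation_adicCompletion_lt_one_iff`,
`Rat.idealRadius_span_natCast_eq`). [cite: Casselman1973, Thm. 1] [cite: HarrisTaylorAMS2001, Thm. A] -/
theorem stub_levelOne_local1951 : ∀ (RD : Summit.Langlands.ReciprocityData ℚ) (ℓ : ℕ) [Fact ℓ.Prime]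
    (ι : PadicAlgCl ℓ ≃+* ℂ) (hcpt : isCompact_glFiniteIntegralLevel 2 ℚ)
    (π : CuspidalAutomorphicRepData 2 ℚ hcpt) (ρ : FramedGaloisRep ℚ (PadicAlgCl ℓ) 2),
    17 ≤ ℓ → ℓ ≠ 1951 →
    (ρ.toGaloisRep.IsIrreducible ∧ (Set.range ρ).Finite ∧ ρ.IsEven ∧
      ρ.toGaloisRep.artinConductorNat = 1951 ∧
      ∃ χ₀ : DirichletCharacter ℂ 1951, orderOf χ₀ = 5 ∧
        ∀ v : HeightOneSpectrum (𝓞 ℚ), v.residueCard ≠ 1951 →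
          ρ.IsUnramifiedAt v ∧ ∃ t d : PadicAlgCl ℓ,
            ρ.HasFrobCharpolyAt v (X ^ 2 - C t * X + C d) ∧
            ι d = (χ₀ (v.residueCard : ZMod 1951))⁻¹ ∧
            (t ^ 2 = 0 ∨ t ^ 2 = d ∨ t ^ 2 = 4 * d ∨ t ^ 4 - 3 * d * t ^ 2 + d ^ 2 = 0)) →
    Summit.Langlands.Corresponds RD ι π.1 ρ →
    ∀ v : HeightOneSpectrum (𝓞 ℚ), v.residueCard = 1951 →
      ∃ (πv : SmoothIrrep (GL (Fin 2) (v.adicCompletion ℚ))) (x₀ : πv.V),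
        π.1.HasLocalComponentAt v πv.ρ ∧ x₀ ≠ 0 ∧
          ∀ m : GL (Fin 2) (v.adicCompletion ℚ), IsLocK1 v (Ideal.span {(1951 : 𝓞 ℚ)}) m →
            πv.ρ m x₀ = x₀ := by
  intro RD ℓ _ ι hcpt π ρ _ hℓ' hyp hcorr v hv
  classical
  obtain ⟨-, hfin, -, hcond, χ₀, -, hχ₀⟩ := hyp
  have hunr : ∀ w : HeightOneSpectrum (𝓞 ℚ), w.residueCard ≠ 1951 → ρ.IsUnramifiedAt w :=
    fun w hw => (hχ₀ w hw).1
  have hp : Nat.Prime 1951 := by norm_num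
  have hvgen : natGenerator v = 1951 := by rw [← Rat.residueCard_eq_natGenerator]; exact hv
  -- `v ∤ ℓ`
  have hvℓ : ((ℓ : ℕ) : 𝓞 ℚ) ∉ v.asIdeal := by
    intro h
    have h1 : natGenerator v ∣ ℓ := (Rat.natCast_mem_asIdeal_iff v).1 h
    rw [hvgen] at h1
    exact hℓ' ((Nat.prime_dvd_prime_iff_eq hp Fact.out).1 h1).symm
  -- local–global compatibility at `v`, (C1), genericity, (C2), (C3)
  obtain ⟨πv, rv, rℂ, hloc, hWD, -, hTr, hcl⟩ := hcorr.2 v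
  obtain ⟨hproP, hgal⟩ := stub_local1951_galois ℓ ι ρ hfin hcond hunr v hv
  obtain ⟨r', hr', hq, hN, hshape⟩ := hgal rv rℂ _ (hWD hvℓ) hTr hcl
  haveI := πv.isIrreducible
  obtain ⟨ψ, hψ, hgen⟩ := π.exists_isGeneric_of_hasLocalComponentAt v πv.ρ πv.isSmooth hloc
  obtain ⟨χ, hχ1, hχ0, hL1, hLχ⟩ :=
    stub_local1951_llc (v.adicCompletion ℚ) hproP (RD.llc v) πv ψ hψ hgen r' hr' hq.symm hN hshape
  haveI : CharZero (v.adicCompletion ℚ) :=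
    charZero_of_injective_algebraMap (algebraMap ℚ (v.adicCompletion ℚ)).injective
  obtain ⟨x₀, hx₀, hfix⟩ := stub_local1951_reptheory (v.adicCompletion ℚ) πv ψ hψ hgen χ hχ1 hχ0
    (fun ν _ _ _ => hL1 ν) (fun ν _ _ _ => hLχ ν)
  -- the `IsLocK1 v (1951)` conditions imply the `K₁(𝔭)` conditions
  have hrad : idealRadius ℚ v (Ideal.span {(1951 : 𝓞 ℚ)}) = WithZero.exp (-1 : ℤ) := by
    have h1 := Rat.idealRadius_span_natCast_eq v (M := 1951) (by norm_num)
    rw [hvgen, Nat.Prime.factorization_self hp] at h1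
    simpa using h1
  have hlt : ∀ x : v.adicCompletion ℚ, Valued.v x ≤ idealRadius ℚ v (Ideal.span {(1951 : 𝓞 ℚ)}) →
      normAbs (v.adicCompletion ℚ) x < 1 := by
    intro x hx
    rw [normAbs_lt_one_iff, valuation_adicCompletion_lt_one_iff]
    rw [hrad] at hx
    calc Valued.v x ≤ WithZero.exp (-1 : ℤ) := hx
      _ < WithZero.exp (0 : ℤ) := WithZero.exp_lt_exp.2 (by norm_num)
      _ = 1 := WithZero.exp_zero
  refine ⟨πv, x₀, hloc, hx₀, fun m hm => hfix m ?_ (hlt _ hm.2.2.1) (hlt _ hm.2.2.2.2)⟩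
  rw [glInt_adicCompletion_eq]
  exact hm.mem_valuedCongruenceSubgroup_one


/-- **`stub_levelOne` (LevelExactness), DERIVED** from `stub_levelOne_spherical` (landed p129624),
`stub_levelOne_assembly` (landed p129825) and the open stub `stub_levelOne_local1951`.
[cite: Casselman1973, Thm. 1] [cite: FlathCorvallis1979, Thm. 3 and Thm. 4] -/
theorem stub_levelOne : ∀ (RD : Summit.Langlands.ReciprocityData ℚ) (ℓ : ℕ) [Fact ℓ.Prime]
    (ι : PadicAlgCl ℓ ≃+* ℂ) (hcpt : isCompact_glFiniteIntegralLevel 2 ℚ)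
    (π : CuspidalAutomorphicRepData 2 ℚ hcpt) (ρ : FramedGaloisRep ℚ (PadicAlgCl ℓ) 2),
    17 ≤ ℓ → ℓ ≠ 1951 →
    (ρ.toGaloisRep.IsIrreducible ∧ (Set.range ρ).Finite ∧ ρ.IsEven ∧
      ρ.toGaloisRep.artinConductorNat = 1951 ∧
      ∃ χ₀ : DirichletCharacter ℂ 1951, orderOf χ₀ = 5 ∧
        ∀ v : HeightOneSpectrum (𝓞 ℚ), v.residueCard ≠ 1951 →
          ρ.IsUnramifiedAt v ∧ ∃ t d : PadicAlgCl ℓ,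
            ρ.HasFrobCharpolyAt v (X ^ 2 - C t * X + C d) ∧
            ι d = (χ₀ (v.residueCard : ZMod 1951))⁻¹ ∧
            (t ^ 2 = 0 ∨ t ^ 2 = d ∨ t ^ 2 = 4 * d ∨ t ^ 4 - 3 * d * t ^ 2 + d ^ 2 = 0)) →
    Summit.Langlands.Corresponds RD ι π.1 ρ →
    ∃ φ ∈ π.1.W, φ ∉ π.1.W' ∧
      ∀ u ∈ gammaOneFiniteLevel ℚ (Ideal.span {(1951 : 𝓞 ℚ)}),
        rightTranslation (AdelicGroupData.gl 2 ℚ)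
            (show (AdelicGroupData.gl 2 ℚ).Adelic from GLn.ofFinite 2 ℚ u) φ - φ ∈ π.1.W' := by
  intro RD ℓ _ ι hcpt π ρ hℓ hℓ' hyp hcorr
  refine stub_levelOne_assembly hcpt π (fun v hv => ?_)
    (stub_levelOne_local1951 RD ℓ ι hcpt π ρ hℓ hℓ' hyp hcorr)
  obtain ⟨-, -, -, -, χ₀, -, hχ₀⟩ := hyp
  exact stub_levelOne_spherical ℚ ℓ hcpt RD ι π ρ v (hχ₀ v hv).1 (hcorr.2 v)


/-! ## Stub 7 — the weight-`0` descent (Maass form dictionary, `π ↦ u_π`) -/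

/-! `stub_descent` — LANDED p131496 (`…StubDescent.lean`, + Aux1–5 p129705 p130163 p130635 p130955 p131141), imported. -/

/-! ## Composition: in-file lemmas -/

/-- **Determinant of the contragredient transport at a Frobenius.**  For `τ g = ι(((ρ g)⁻¹)ᵀ)` and
`charpoly ρ(Frob_v) = X² - tX + d` (arithmetic Frobenius): `det τ(Frob_v) = (ι d)⁻¹`
(`det (M⁻¹)ᵀ = (det M)⁻¹` and `det M` is the constant coefficient of a monic quadratic
characteristic polynomial). [folklore] -/
theorem det_dual_transport_eq_inv {ℓ : ℕ} [Fact ℓ.Prime] (ι : PadicAlgCl ℓ ≃+* ℂ)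
    (ρ : FramedGaloisRep ℚ (PadicAlgCl ℓ) 2) (τ : FramedArtinRep ℚ 2)
    (hτ : ∀ g : Field.absoluteGaloisGroup ℚ, ((τ g : GL (Fin 2) ℂ) : Matrix (Fin 2) (Fin 2) ℂ) =
      ((((ρ g)⁻¹ : GL (Fin 2) (PadicAlgCl ℓ)) : Matrix (Fin 2) (Fin 2) (PadicAlgCl ℓ))ᵀ).map
        (ι : PadicAlgCl ℓ → ℂ))
    {v : HeightOneSpectrum (𝓞 ℚ)} {t d : PadicAlgCl ℓ}
    (hP : ρ.HasFrobCharpolyAt v (X ^ 2 - C t * X + C d))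
    {𝔓 : Ideal (absIntegers (𝓞 ℚ) ℚ)} (h𝔓 : 𝔓 ∈ v.primesAbove)
    {Φ : Field.absoluteGaloisGroup ℚ} (hΦ : IsArithFrobAt (𝓞 ℚ) Φ 𝔓) :
    ((FramedRep.det τ Φ : ℂˣ) : ℂ) = (ι d)⁻¹ := by
  have hchar : (((ρ Φ : GL (Fin 2) (PadicAlgCl ℓ)) : Matrix (Fin 2) (Fin 2) (PadicAlgCl ℓ))).charpoly =
      X ^ 2 - C t * X + C d := hP 𝔓 h𝔓 Φ hΦ
  have hdetρ : (((ρ Φ : GL (Fin 2) (PadicAlgCl ℓ)) : Matrix (Fin 2) (Fin 2) (PadicAlgCl ℓ))).det = d := by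
    rw [Matrix.det_eq_sign_charpoly_coeff, hchar]
    simp
  have hdetinv : ((((ρ Φ)⁻¹ : GL (Fin 2) (PadicAlgCl ℓ)) :
      Matrix (Fin 2) (Fin 2) (PadicAlgCl ℓ))).det = d⁻¹ := by
    rw [← Matrix.GeneralLinearGroup.val_det_apply, map_inv, Units.val_inv_eq_inv_val,
      Matrix.GeneralLinearGroup.val_det_apply, hdetρ]
  rw [FramedRep.det_apply, Matrix.GeneralLinearGroup.val_det_apply, hτ Φ]
  have hmap : ((((ρ Φ)⁻¹ : GL (Fin 2) (PadicAlgCl ℓ)) : Matrix (Fin 2) (Fin 2) (PadicAlgCl ℓ))ᵀ).map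
      (ι : PadicAlgCl ℓ → ℂ) =
      (ι : PadicAlgCl ℓ →+* ℂ).mapMatrix
        ((((ρ Φ)⁻¹ : GL (Fin 2) (PadicAlgCl ℓ)) : Matrix (Fin 2) (Fin 2) (PadicAlgCl ℓ))ᵀ) := by
    rw [RingHom.mapMatrix_apply]
    rfl
  rw [hmap, ← RingHom.map_det, Matrix.det_transpose, hdetinv, RingHom.coe_coe, map_inv₀]

/-- A Dirichlet character of order `5` is even: `χ(-1) = 1` (`χ(-1) = ±1` and `χ⁵ = 1`).
[folklore] -/
theorem dirichletCharacter_neg_one_of_orderOf_eq_five {N : ℕ} (χ : DirichletCharacter ℂ N)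
    (h : orderOf χ = 5) : χ (-1) = 1 := by
  rcases χ.even_or_odd with he | ho
  · exact he
  · exfalso
    have h5 : χ ^ 5 = 1 := h ▸ pow_orderOf_eq_one χ
    have h1 : (χ ^ 5) (((-1 : (ZMod N)ˣ) : ZMod N)) = 1 := by
      rw [h5, MulChar.one_apply_coe]
    rw [MulChar.pow_apply_coe, Units.val_neg, Units.val_one, ho] at h1
    norm_num at h1

/-- For a continuous `1`-periodic `f : ℝ → ℂ`, `∫₀ⁿ f = n ∫₀¹ f`. [folklore] -/
theorem intervalIntegral_zero_nat_of_periodic {f : ℝ → ℂ} (hf : Function.Periodic f 1)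
    (hc : Continuous f) (n : ℕ) :
    ∫ x in (0 : ℝ)..(n : ℝ), f x = (n : ℂ) * ∫ x in (0 : ℝ)..1, f x := by
  induction n with
  | zero => simp
  | succ n ih =>
    rw [Nat.cast_succ, ← intervalIntegral.integral_add_adjacent_intervals (hc.intervalIntegrable 0 n)
      (hc.intervalIntegrable (n : ℝ) ((n : ℝ) + 1)), ih]
    have h := hf.intervalIntegral_add_eq (n : ℝ) 0
    rw [zero_add] at h
    rw [h]
    push_cast
    ring

/-- **The icosahedral fingerprint from the Frobenius data**: if `T² = 0 ∨ T² = D ∨ T² = 4D ∨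
T⁴ - 3DT² + D² = 0` with `D ≠ 0` then `T²/D ∈ Φ = {0, 1, 4, (3 ± √5)/2}` (the roots of
`x² - 3x + 1` are `(3 ± √5)/2`). [folklore] -/
theorem sq_div_mem_fingerprint {T D : ℂ} (hD : D ≠ 0)
    (h : T ^ 2 = 0 ∨ T ^ 2 = D ∨ T ^ 2 = 4 * D ∨ T ^ 4 - 3 * D * T ^ 2 + D ^ 2 = 0) :
    T ^ 2 / D ∈ ({0, 1, 4, (((3 + Real.sqrt 5) / 2 : ℝ) : ℂ), (((3 - Real.sqrt 5) / 2 : ℝ) : ℂ)} : Set ℂ) := by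
  simp only [Set.mem_insert_iff, Set.mem_singleton_iff]
  rcases h with h | h | h | h
  · exact Or.inl (by rw [h, zero_div])
  · exact Or.inr (Or.inl (by rw [h, div_self hD]))
  · exact Or.inr (Or.inr (Or.inl (by rw [h, mul_div_assoc, div_self hD, mul_one])))
  · right; right; right
    have h5 : (((Real.sqrt 5 : ℝ)) : ℂ) ^ 2 = 5 := by
      rw [← Complex.ofReal_pow, Real.sq_sqrt (by norm_num : (0 : ℝ) ≤ 5)]
      norm_num
    have hF : (T ^ 2 / D) ^ 2 - 3 * (T ^ 2 / D) + 1 = 0 := by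
      have : (T ^ 2 / D) ^ 2 - 3 * (T ^ 2 / D) + 1 = (T ^ 4 - 3 * D * T ^ 2 + D ^ 2) / D ^ 2 := by
        field_simp
      rw [this, h, zero_div]
    have hprod : (T ^ 2 / D - (((3 + Real.sqrt 5) / 2 : ℝ) : ℂ)) *
        (T ^ 2 / D - (((3 - Real.sqrt 5) / 2 : ℝ) : ℂ)) = 0 := by
      have e : (T ^ 2 / D - (((3 + Real.sqrt 5) / 2 : ℝ) : ℂ)) *
          (T ^ 2 / D - (((3 - Real.sqrt 5) / 2 : ℝ) : ℂ)) =
          (T ^ 2 / D) ^ 2 - 3 * (T ^ 2 / D) + (9 - (((Real.sqrt 5 : ℝ)) : ℂ) ^ 2) / 4 := by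
        push_cast
        ring
      rw [e, h5]
      linear_combination hF
    rcases mul_eq_zero.mp hprod with h1 | h1
    · exact Or.inl (sub_eq_zero.mp h1)
    · exact Or.inr (sub_eq_zero.mp h1)



/-! ## Composition -/

/-- **The crux BY NAME from the seven stubs.**  Contragredient transport `τ = ι ∘ ρ^∨` puts the
correspondent in Tunnell's `IsPiOfArtinRep` world (`Corresponds.1`); the centre acts by `ψ_{χ₀}`
(`stub_centralCharacter`, `det τ(Frob) = χ₀`), which gives the even archimedean sign (`χ₀(-1) = 1`,
order `5`); `stub_archParameter` gives `{a, -a}`; `stub_levelOne` the `K₁(1951)`-vector;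
`stub_glue` one clean vector; `stub_descent` the Maass form of eigenvalue `1/4 - a²`; `stub_barrier`
forces `a = 0`; `stub_satakeSmallPrimes` + the Hecke dictionary give `μ_p = α + β`, `χ₀(p) = αβ`,
and the Frobenius data give `(α + β)²/(αβ) = ι(t)²/ι(d) ∈ Φ`. [folklore] -/
theorem CorrespondentFingerprint_of :
    Summit.Langlands.Langlands.Theses.QuarterDeficit1951.CorrespondentFingerprint := by
  unfold Summit.Langlands.Langlands.Theses.QuarterDeficit1951.CorrespondentFingerprint
  dsimp only
  intro RD ℓ _ ι hcpt π ρ hℓ hℓ1951 hρ hLalg hcorr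
  obtain ⟨hirr, hfin, hevenρ, hcond, χ₀, hχ₀, hfrob⟩ := hρ
  haveI : NeZero (1951 : ℕ) := ⟨by norm_num⟩
  -- (0) contragredient transport `τ = ι ∘ ρ^∨`, `IsPiOfArtinRep τ π`
  have hfinR : Finite ρ.toMonoidHom.range := by
    have e : ((ρ.toMonoidHom.range : Subgroup (GL (Fin 2) (PadicAlgCl ℓ))) :
        Set (GL (Fin 2) (PadicAlgCl ℓ))) = Set.range ρ := by
      rw [MonoidHom.coe_range]; rfl
    exact Set.finite_coe_iff.mpr (e ▸ hfin)
  obtain ⟨τ, hτ⟩ := ArtinWeightRealisationLevel.exists_dual_transport ι ρ hfinR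
  have hπτ : IsPiOfArtinRep τ π.1 := hcorr.1.mono fun v hv =>
    (ArtinWeightRealisationLevel.satakeFrobCompatibleAt_iff_of_dual_transport ι ρ τ hτ π.1 v).1 hv
  -- (1) `det τ(Frob_v) = χ₀(q_v)` at the good places
  have hdet : ∀ v : HeightOneSpectrum (𝓞 ℚ), τ.IsUnramifiedAt v → ¬ natGenerator v ∣ 1951 →
      ∀ 𝔓 ∈ v.primesAbove, ∀ Φ : Field.absoluteGaloisGroup ℚ, IsArithFrobAt (𝓞 ℚ) Φ 𝔓 →
        ((FramedRep.det τ Φ : ℂˣ) : ℂ) = χ₀ ((v.residueCard : ℕ) : ZMod 1951) := by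
    intro v _ hvN 𝔓 h𝔓 Φ hΦ
    have hq : v.residueCard ≠ 1951 := by
      intro h
      apply hvN
      rw [← Rat.residueCard_eq_natGenerator, h]
    obtain ⟨-, t, d, hP, hιd, -⟩ := hfrob v hq
    rw [det_dual_transport_eq_inv ι ρ τ hτ hP h𝔓 hΦ, hιd, inv_inv]
  -- (2) the centre acts by `ψ_{χ₀}`
  have hcen := stub_centralCharacter hcpt π.1 τ 1951 χ₀ hπτ hdet
  -- (3) the even sign: `-1_∞` acts trivially (`χ₀(-1) = 1`)
  have hχneg : χ₀ (-1) = 1 := dirichletCharacter_neg_one_of_orderOf_eq_five χ₀ hχ₀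
  have heven : ∀ φ ∈ π.1.W, rightTranslation (AdelicGroupData.gl 2 ℚ)
      ((AutomorphyDatum.gl 2 ℚ hcpt).ofArch ⟨-1, trivial⟩) φ - φ ∈ π.1.W' := by
    intro φ hφ
    have key := hcen (Rat.infIdele (-1)) φ hφ
    rw [HeckeCharacter.ofDirichlet_infIdele_neg_one, hχneg, one_smul] at key
    rw [ofArch_neg_one_eq_scalar_infIdele]
    exact key
  -- (4) the archimedean parameter `{a, -a}`
  obtain ⟨a, harch⟩ := stub_archParameter hcpt π.1 τ hπτ hLalg
  -- (5) the `K₁(1951)`-vector, the glue, the descent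
  have hfix := stub_levelOne RD ℓ ι hcpt π ρ hℓ hℓ1951
    ⟨hirr, hfin, hevenρ, hcond, χ₀, hχ₀, hfrob⟩ hcorr
  obtain ⟨φ₀, hcuspφ, hφ0, hK1, hcenφ, hAG, hsm, hw0, hZ, hcas, hhecke⟩ :=
    stub_glue hcpt π 1951 χ₀ a hcen heven harch hfix
  obtain ⟨hM, hu0, hTp⟩ := stub_descent hcpt 1951 χ₀ (2 * (a : ℝ) ^ 2 - 1 / 2) φ₀ hcuspφ hφ0 hK1
    hcenφ hAG hsm hw0 hZ hcas
  set u : UpperHalfPlane → ℂ := fun z => φ₀ (Rat.ofRealGLA (upperHalfPlaneToGL z)) with hu_def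
  -- (6) `u` is `1`-periodic (`T ∈ Γ₀(1951)`)
  have hT : ModularGroup.T ∈ CongruenceSubgroup.Gamma0 1951 := by
    rw [CongruenceSubgroup.Gamma0_mem, ModularGroup.coe_T]
    simp
  have hper : ∀ z : UpperHalfPlane, u ((1 : ℝ) +ᵥ z) = u z := by
    intro z
    have h := hM.slash ModularGroup.T hT z
    rw [UpperHalfPlane.modular_T_smul, ModularGroup.coe_T] at h
    rw [h]
    simp
  -- (7) the barrier forces `a = 0`
  have ha0 : a = 0 := by
    by_contra ha
    obtain ⟨z₀, hz₀⟩ := hu0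
    apply hz₀
    refine stub_barrier u ((a : ℝ) ^ 2 - 1 / 4) ?_ hM.isC2 ?_ hper hM.bounded z₀
    · have h1 : (1 : ℤ) ≤ a ^ 2 := by
        have := Int.one_le_abs ha
        nlinarith [abs_nonneg a, sq_abs a]
      have h1' : (1 : ℝ) ≤ (a : ℝ) ^ 2 := by exact_mod_cast h1
      linarith
    · intro z
      have h := hM.eigen z
      push_cast at h ⊢
      linear_combination h
  subst ha0
  have e4 : (-(2 * ((0 : ℤ) : ℝ) ^ 2 - 1 / 2) / 2 : ℝ) = 1 / 4 := by norm_num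
  rw [e4] at hM
  -- (8) continuity of `u` along horizontal lines (for the period integral)
  have hcont : ∀ y : ℝ, 0 < y →
      Continuous (fun x : ℝ => u (UpperHalfPlane.ofComplex ((x : ℂ) + y * Complex.I))) := by
    intro y hy
    have h := hM.isC2.continuousOn.comp_continuous
      (f := fun x : ℝ => ((x : ℂ) + y * Complex.I)) (by fun_prop) (fun x => by simp [hy])
    exact h
  have hperx : ∀ y : ℝ, 0 < y →
      Function.Periodic (fun x : ℝ => u (UpperHalfPlane.ofComplex ((x : ℂ) + y * Complex.I))) 1 := by
    intro y hy x
    have him : 0 < ((x : ℂ) + y * Complex.I).im := by simp [hy]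
    have him' : 0 < (((x + 1 : ℝ) : ℂ) + y * Complex.I).im := by simp [hy]
    have e : UpperHalfPlane.ofComplex (((x + 1 : ℝ) : ℂ) + y * Complex.I) =
        (1 : ℝ) +ᵥ UpperHalfPlane.ofComplex ((x : ℂ) + y * Complex.I) := by
      apply UpperHalfPlane.ext
      rw [UpperHalfPlane.ofComplex_apply_of_im_pos him', UpperHalfPlane.coe_vadd,
        UpperHalfPlane.ofComplex_apply_of_im_pos him]
      push_cast
      ring
    simp only
    rw [e, hper]
  -- (9) the Hecke eigenvalues and the fingerprint at a good prime `p < 17`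
  have key : ∀ p : ℕ, p.Prime → p ≠ 1951 → p < 17 →
      ∃ μ φ : ℂ, φ ∈ ({0, 1, 4, (((3 + Real.sqrt 5) / 2 : ℝ) : ℂ), (((3 - Real.sqrt 5) / 2 : ℝ) : ℂ)} : Set ℂ) ∧
        (∀ z : UpperHalfPlane, ((Real.sqrt p : ℝ) : ℂ)⁻¹ *
            ((∑ b ∈ Finset.range p, u (UpperHalfPlane.ofComplex (((z : ℂ) + b) / p))) +
              χ₀ (p : ZMod 1951) * u (UpperHalfPlane.ofComplex ((p : ℂ) * z))) = μ * u z) ∧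
        μ ^ 2 * (starRingEnd ℂ) (χ₀ (p : ZMod 1951)) = φ := by
    intro p hp hp1951 hp17
    set v : HeightOneSpectrum (𝓞 ℚ) := (primesEquiv (R := 𝓞 ℚ)).symm ⟨p, hp⟩ with hv_def
    have hv : natGenerator v = p := congrArg Subtype.val ((primesEquiv (R := 𝓞 ℚ)).apply_symm_apply ⟨p, hp⟩)
    have hq : v.residueCard = p := by rw [Rat.residueCard_eq_natGenerator, hv]
    have hvN : ¬ v.asIdeal ∣ Ideal.span {((1951 : ℕ) : 𝓞 ℚ)} := by
      rw [← Rat.natGenerator_dvd_iff, hv]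
      intro hdvd
      have h1951 : Nat.Prime 1951 := by norm_num
      rcases (Nat.dvd_prime h1951).mp hdvd with h | h
      · exact hp.one_lt.ne' h
      · exact hp1951 h
    have hvℓ : ((ℓ : ℕ) : 𝓞 ℚ) ∉ v.asIdeal := by
      rw [Rat.natCast_mem_asIdeal_iff, hv]
      intro hdvd
      rcases (Nat.dvd_prime Fact.out).mp hdvd with h | h
      · exact hp.one_lt.ne' h
      · omega
    obtain ⟨hunr, t, d, hP, hιd, hdisj⟩ := hfrob v (by rw [hq]; exact_mod_cast hp1951)
    -- Satake–Frobenius compatibility at `v` from local–global compatibility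
    obtain ⟨α, hα, -, hαP⟩ := stub_satakeSmallPrimes RD ℓ ι hcpt π ρ v hfin hvℓ hunr (hcorr.2 v)
    obtain ⟨α₁, α₂, rfl⟩ := Multiset.card_eq_two.mp hα.card_eq
    -- compare the two Frobenius polynomials
    obtain ⟨𝔓, h𝔓⟩ := v.primesAbove_nonempty
    obtain ⟨Φ, hΦ⟩ := HeightOneSpectrum.exists_isArithFrobAt_of_mem_primesAbove_holds h𝔓
    have hpoly : X ^ 2 - C t * X + C d =
        X ^ 2 - C (ι.symm α₁⁻¹ + ι.symm α₂⁻¹) * X + C (ι.symm α₁⁻¹ * ι.symm α₂⁻¹) := by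
      rw [← hP 𝔓 h𝔓 Φ hΦ, hαP 𝔓 h𝔓 Φ hΦ, arithFrobPolyOfSatake_one, Multiset.insert_eq_cons,
        Multiset.map_cons, Multiset.map_singleton, Multiset.prod_cons, Multiset.prod_singleton]
      simp only [C_add, C_mul]
      ring
    have ht : t = ι.symm α₁⁻¹ + ι.symm α₂⁻¹ := by
      have h := congrArg (fun P : (PadicAlgCl ℓ)[X] => P.coeff 1) hpoly
      simp only [coeff_add, coeff_sub, coeff_X_pow, coeff_C_mul, coeff_X_one, coeff_C,
        if_neg (by norm_num : (1 : ℕ) ≠ 2), if_neg (one_ne_zero)] at h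
      linear_combination -h
    have hd : d = ι.symm α₁⁻¹ * ι.symm α₂⁻¹ := by
      have h := congrArg (fun P : (PadicAlgCl ℓ)[X] => P.coeff 0) hpoly
      simp only [coeff_add, coeff_sub, coeff_X_pow, coeff_C_mul, coeff_X_zero, coeff_C_zero,
        if_neg (by norm_num : (0 : ℕ) ≠ 2), mul_zero, sub_zero, zero_add] at h
      exact h
    have hιt : ι t = α₁⁻¹ + α₂⁻¹ := by
      rw [ht, map_add, RingEquiv.apply_symm_apply, RingEquiv.apply_symm_apply]
    have hιd' : ι d = α₁⁻¹ * α₂⁻¹ := by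
      rw [hd, map_mul, RingEquiv.apply_symm_apply, RingEquiv.apply_symm_apply]
    -- `χ₀(p) ≠ 0`, so `ι d ≠ 0` and `α₁, α₂ ≠ 0`
    have hcop : Nat.Coprime p 1951 := by
      rw [Nat.coprime_comm, Nat.Prime.coprime_iff_not_dvd (by norm_num : Nat.Prime 1951)]
      intro h
      rcases (Nat.dvd_prime hp).mp h with h' | h'
      · norm_num at h'
      · exact hp1951 h'.symm
    have hχp : χ₀ (p : ZMod 1951) ≠ 0 := by
      rw [← ZMod.coe_unitOfCoprime p hcop]
      exact (χ₀.toUnitHom (ZMod.unitOfCoprime p hcop)).ne_zero ∘ (by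
        intro h; rw [← MulChar.coe_toUnitHom] at h; exact h)
    have hD : ι d ≠ 0 := by
      rw [hιd, hq]
      exact inv_ne_zero (by exact_mod_cast hχp)
    have hα₁ : α₁ ≠ 0 := by
      intro h; apply hD; rw [hιd', h, inv_zero, zero_mul]
    have hα₂ : α₂ ≠ 0 := by
      intro h; apply hD; rw [hιd', h, inv_zero, mul_zero]
    -- the Hecke dictionary: `T_p u = (α₁ + α₂) u`, `χ₀(p) = α₁ α₂`
    obtain ⟨h1, h2⟩ := hhecke v (by exact_mod_cast hvN) _ hα
    obtain ⟨hTpz, hc₂⟩ := hTp v (by exact_mod_cast hvN) _ _ h1 h2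
    rw [Multiset.insert_eq_cons, Multiset.esymm_pair_two] at hc₂
    have hsqrt : ((Real.sqrt p : ℝ) : ℂ) ≠ 0 := by
      exact_mod_cast (Real.sqrt_pos.mpr (by exact_mod_cast hp.pos)).ne'
    refine ⟨α₁ + α₂, (α₁ + α₂) ^ 2 * (starRingEnd ℂ) (χ₀ (p : ZMod 1951)), ?_, ?_, rfl⟩
    · -- the fingerprint: `(α₁ + α₂)² conj(χ₀ p) = (ι t)² / ι d ∈ Φ`
      have hnorm : ‖χ₀ (p : ZMod 1951)‖ = 1 := by
        rw [← ZMod.coe_unitOfCoprime p hcop]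
        exact χ₀.unit_norm_eq_one (ZMod.unitOfCoprime p hcop)
      have hconj : (starRingEnd ℂ) (χ₀ (p : ZMod 1951)) = (χ₀ (p : ZMod 1951))⁻¹ :=
        (Complex.inv_eq_conj hnorm).symm
      have hχαβ : χ₀ (p : ZMod 1951) = α₁ * α₂ := by
        rw [hv] at hc₂
        exact hc₂.symm
      have hval : (α₁ + α₂) ^ 2 * (starRingEnd ℂ) (χ₀ (p : ZMod 1951)) = (ι t) ^ 2 / ι d := by
        rw [hconj, hχαβ, hιt, hιd']
        field_simp
        ring
      rw [hval]
      refine sq_div_mem_fingerprint hD ?_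
      rcases hdisj with h | h | h | h
      · left; rw [← map_pow, h, map_zero]
      · right; left; rw [← map_pow, h]
      · right; right; left
        rw [← map_pow, h, map_mul, map_ofNat]
      · right; right; right
        have := congrArg ι h
        rw [map_zero] at this
        rw [← this]
        simp only [map_add, map_sub, map_mul, map_pow, map_ofNat]
    · intro z
      have h := hTpz z
      rw [hv, maassHeckeOp_prime 1951 χ₀ hp u z, Multiset.insert_eq_cons, Multiset.esymm_pair_one,
        hq] at h
      rw [h]
      congr 1
      field_simp
  -- (10) assemble the conclusion
  refine ⟨χ₀, hχ₀, u, ⟨hM.isC2, hM.eigen, hM.slash, ?_, ?_, hM.bounded⟩, hu0, ?_⟩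
  · -- cusp `∞` (width `1`) from the period-`1951` mean and `1`-periodicity
    intro y hy
    have h := hM.cuspidal 1 y hy
    simp only [one_smul] at h
    rw [intervalIntegral_zero_nat_of_periodic (hperx y hy) (hcont y hy) 1951] at h
    exact (mul_eq_zero.mp h).resolve_left (by norm_num)
  · -- cusp `0` (width `1951`)
    intro y hy
    have h := hM.cuspidal ModularGroup.S y hy
    exact_mod_cast h
  · intro p hp
    simp only [Finset.mem_insert, Finset.mem_singleton] at hp
    rcases hp with rfl | rfl | rfl | rfl | rfl | rfl <;>
      exact key _ (by norm_num) (by norm_num) (by norm_num)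

end Summit.Langlands.Langlands.Theorems.CorrespondentFingerprint

end
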